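import Summits.ResolutionOfSingularities.ResolutionOfSingularities.Theorems.MarkedTransferCampaignW46MohWindowSurfaceCubeCentre
import Summits.ResolutionOfSingularities.ResolutionOfSingularities.Theorems.MarkedTransferCampaignW46MohWindowSurfaceCubeChild
import Summits.ResolutionOfSingularities.ResolutionOfSingularities.Theorems.MarkedTransferCampaignW46MohWindowSurfaceHeavyChart
import HarnessLib

/-!
# [OURS · L1 W4.6 rung (iii-2), HEAVY-ROOT SIDE, `p = 2`] Surface Moh window — the CHILDREN OF AN ADMITTED CENTRE are FROZEN or
# PURE (cell res-hironaka, LADDER-RESOLUTION rung L, D-0089; seat res-L1-s46-pv-5 gen 4; host MarkedTransfer,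
# `--supports stmt-ResolutionOfSingularities-16155 --as helper`; statement file `…CampaignW46MohWindowSurface.lean`)

HONEST FRAMING. Nothing here is a statement of H. Hironaka's manuscript [Hironaka2017] and nothing here asserts that any
statement of it holds. THEOREMS about the OURS regime `CampaignW46.Regime.mohWindowSurface` at `p = 2`, assembling res-D-pv-050's
chart datum with prescribed multiplicity predicate (`…HeavyChart.lean`, `exists_core_data_of_factor`), `…CubeCentre.lean` (the
centre is a cube point), `…CubeChild.lean` (cleaning, cube-child shape, degenerate case) and `…FrozenShape.lean`. Step (3) of
res-L1-s46-pv-5's «p = 2 programme». AI-written; AI review is weaker than expert review. No `sorry`; axioms standard.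

WHAT IS PROVED. `centreChild_of_chart` (ring level, one Rees chart `i ∈ {0, 1}`): at a singular point `ξ′` of the blow-up of a
window point whose residue cubic is a cube at every prime (multiplicity `0` or `3`), if `ξ′` carries a coefficient window
presentation, then `J′_{ξ′}` has either the FROZEN shape `(w² + s²η + r)` (unit `q`-component of `η`, `r ∈ 𝔪⁴`) or the PURE
cube-child shape `(w² + s²η + s q³ G)` (`η_S` unit, `η_Q ∈ 𝔪`, `G` unit). `frozen_or_pure_of_over_centre` (scheme level): for a
§2.1-permissible blow-up of a state of `Regime.mohWindowSurface` (`p = 2`) with transform again in the regime, EVERY singular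
point of the transform over the centre is frozen or pure. With `…PureChildStep.lean` (the children of a pure point are frozen) and
`…FrozenShape.lean` + `…Freeze.lean` (a frozen point is never an admitted centre): along an in-regime sequence no grandchild of a
centre is ever a centre — the combinatorial heart of the termination of the typed procedure in the purely inseparable surface
window at `p = 2` (run-level assembly: successor file). [ZariskiSamuel1960] [Matsumura1987] [HauserWagner2014]
-/

noncomputable section

set_option linter.dupNamespace false -- mandated namespace of this single-conjunct summit

open CategoryTheory AlgebraicGeometry TopologicalSpace IsLocalRing

namespace Summit.ResolutionOfSingularities.ResolutionOfSingularities.Theorems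

namespace CampaignW46

open Literature.AlgebraicGeometry.Resolution
open Literature.AlgebraicGeometry.Hironaka2017.S02Preliminaries
open Literature.AlgebraicGeometry.Hironaka2017.Datum
open Literature.AlgebraicGeometry.Hironaka2017.S16Proof
open Scheme.IdealSheafData
open Polynomial

universe u

namespace MohWindowSurface

/-! ## 1. Ring level: one Rees chart over a cube point -/

/-- **[OURS · L1 W4.6 rung (iii-2), `p = 2`] THE CHILD OF A CUBE POINT IS FROZEN OR PURE, ring level.** `R → L` (`ψ`) the stalk
map at a point of the blow-up of a window point (`p = 2`, `d = 3`) presented through the Rees chart `i ∈ {0, 1}`, whose residue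
cubic `Σ ā_k X^{u_k}` is a cube at every prime (`μ ∈ {0, 3}`); transform ideal `I′` singular (`⊆ 𝔪²`) and carrying a coefficient
window presentation `(z₁² + Σ a′_k x₁^{3−k} y₁^k)` with a unit coefficient. Then `I′ = (w² + (s²η + r))` for a regular system of
parameters `(s, q, w)` of `L` with EITHER `η ≡ η_S s + η_Q q + η_W w`, `η_Q` a unit, `r ∈ 𝔪⁴` (FROZEN) OR `r = s q³ G`, `G` a unit,
`η_S` a unit, `η_Q ∈ 𝔪` (PURE). NOT a statement of the manuscript. [folklore] -/
theorem centreChild_of_chart {R : Type u} [CommRing R] [IsRegularLocalRing R]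
    (h3 : (maximalIdeal R).spanFinrank = 3) (c : Fin 3 → R) (hc : Ideal.span (Set.range c) = maximalIdeal R)
    {i i' : Fin 3} (hi : i ≠ 2) (hi' : i' ≠ 2) (hii' : i ≠ i') (a : ℕ → R) (u : ℕ → ℕ) (hu : ∀ k, u k ≤ 3)
    (hfac : ∀ π : (ResidueField R)[X], Prime π → ∃ (μ : ℕ) (G₀ : (ResidueField R)[X]),
      (μ = 0 ∨ μ = 3) ∧ (∑ k ∈ Finset.range (3 + 1), C (residue R (a k)) * X ^ (u k)) = π ^ μ * G₀ ∧ ¬ π ∣ G₀)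
    (𝔴 : Ideal (chartRing c i)) [𝔴.IsPrime] (h𝔴 : 𝔴.comap (chartBase c i) = maximalIdeal R)
    (L : Type u) [CommRing L] [IsLocalRing L] [Algebra (chartRing c i) L] [IsLocalization.AtPrime L 𝔴] [CharP L 2]
    (h3L : (maximalIdeal L).spanFinrank = 3) (ψ : R →+* L)
    (hψ : ∀ r, ψ r = (algebraMap (chartRing c i) L : chartRing c i →+* L) (chartBase c i r))
    {I' : Ideal L}
    (hI' : I' = Submodule.colon (Ideal.span {ψ (c 2 ^ 2 + ∑ k ∈ Finset.range (3 + 1), a k * c i ^ (3 - u k) * c i' ^ (u k))})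
      ((Ideal.span {ψ (c i)} ^ 2 : Ideal L) : Set L))
    (hsing : I' ≤ maximalIdeal L ^ 2) {x₁ y₁ z₁ : L} (hxyz₁ : Ideal.span {x₁, y₁, z₁} = maximalIdeal L) {a₁ : ℕ → L}
    (hunit₁ : ∃ j ≤ 3, IsUnit (a₁ j))
    (hI₁ : I' = Ideal.span {z₁ ^ 2 + ∑ k ∈ Finset.range (3 + 1), a₁ k * x₁ ^ (3 - k) * y₁ ^ k}) :
    ∃ s q w η r η_S η_Q η_W : L, Ideal.span {s, q, w} = maximalIdeal L ∧
      η - (η_S * s + η_Q * q + η_W * w) ∈ maximalIdeal L ^ 2 ∧ I' = Ideal.span {w ^ 2 + (s ^ 2 * η + r)} ∧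
      ((IsUnit η_Q ∧ r ∈ maximalIdeal L ^ 4) ∨ (∃ G : L, IsUnit G ∧ r = s * q ^ 3 * G ∧ IsUnit η_S ∧ η_Q ∈ maximalIdeal L)) := by
  classical
  set alg : chartRing c i →+* L := (algebraMap (chartRing c i) L : chartRing c i →+* L) with halg
  -- `L` is regular, `t = ψ (c i)` is a regular parameter
  have hz0 : Ideal.span (Set.range (Fin.append c (fun k : Fin 0 => Fin.elim0 k : Fin 0 → R))) = maximalIdeal R := by
    rw [span_range_append_elim0]; exact hc
  have hd0 : (maximalIdeal R).spanFinrank = 3 + 0 := by rw [h3]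
  have hrsop := isRsopPart_chartFamily_reesChart c i (fun k : Fin 0 => Fin.elim0 k) hz0 hd0 𝔴 h𝔴 L
    (a := 0) (fun k : Fin 0 => Fin.elim0 k) (Function.injective_of_subsingleton _) (fun k => Fin.elim0 k)
  haveI hLreg : IsRegularLocalRing L := hrsop.isRegularLocalRing
  haveI : IsDomain L := isDomain_of_isRegularLocalRing L
  set t : L := ψ (c i) with htdef
  have ht : t ∈ maximalIdeal L := by
    have h0 := hrsop.mem_maximalIdeal 0
    rw [htdef, hψ]; simpa only [chartFamily, Fin.cons_zero] using h0
  have ht0 : t ≠ 0 := by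
    have h0 := hrsop.ne_zero 0
    rw [htdef, hψ]; simpa only [chartFamily, Fin.cons_zero] using h0
  have ht2 : t ∉ maximalIdeal L ^ 2 := by
    have h0 := hrsop.not_mem_sq 0
    rw [htdef, hψ]; simpa only [chartFamily, Fin.cons_zero] using h0
  -- chart relations and the pulled-back equation
  have hrel : ∀ l, ψ (c l) = t * alg (chartGen c i l) := fun l => by
    rw [htdef, hψ, hψ, halg, ← map_mul, ← reesChartBase_apply_eq_mul_chartGen c i l]
  set F : L := ∑ k ∈ Finset.range (3 + 1), alg (chartBase c i (a k)) * alg (chartGen c i i') ^ (u k) with hF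
  have hFψ : ∑ k ∈ Finset.range (3 + 1), ψ (a k) * alg (chartGen c i i') ^ (u k) = F := by
    rw [hF]; refine Finset.sum_congr rfl fun k _ => ?_; rw [hψ]
  have hfac' := map_window_eq_chart ψ (hrel i') (hrel 2) (show 2 ≤ 3 by norm_num) a u hu
  rw [hFψ, show 3 - 2 = 1 from rfl, pow_one] at hfac'
  set g₁ : L := alg (chartGen c i 2) ^ 2 + t * F with hg₁
  have hI'eq : I' = Ideal.span {g₁} := by
    rw [hI', hfac', colon_span_pow_mul (mem_nonZeroDivisors_of_ne_zero ht0)]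
  have hg₁m : g₁ ∈ maximalIdeal L ^ 2 := hsing (by rw [hI'eq]; exact Ideal.mem_span_singleton_self _)
  -- `e₂ ∈ 𝔪_L`
  have hz : alg (chartGen c i 2) ∈ maximalIdeal L := by
    have h1 : t * F ∈ maximalIdeal L := Ideal.mul_mem_right _ _ ht
    have h2 : alg (chartGen c i 2) ^ 2 ∈ maximalIdeal L := by
      have := Ideal.sub_mem _ (Ideal.pow_le_self two_ne_zero hg₁m) h1
      rwa [hg₁, add_sub_cancel_right] at this
    exact (maximalIdeal.isMaximal L).isPrime.mem_of_pow_mem 2 h2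
  -- the chart datum with multiplicity `0` or `3`
  obtain ⟨-, ρ, G, μ, hμ, hGu, hgen, hfρ⟩ :=
    exists_core_data_of_factor h3 c hc hi hi' hii' a u hfac 𝔴 h𝔴 L h3L hz
  rw [← hψ] at hgen hfρ
  change F - ρ ^ μ * G ∈ Ideal.span {t} at hfρ
  obtain ⟨H₀, hH₀⟩ := Ideal.mem_span_singleton'.mp hfρ
  -- `μ = 0` is impossible: the point would not be singular
  rcases hμ with rfl | rfl
  · exfalso
    rw [pow_zero, one_mul] at hH₀
    have hFG : F = G + H₀ * t := by linear_combination -hH₀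
    have hunitv : IsUnit (G + t * H₀) := by
      by_contra hnu
      have hm : G + t * H₀ ∈ maximalIdeal L := (mem_maximalIdeal _).mpr (mem_nonunits_iff.mpr hnu)
      have : G ∈ maximalIdeal L := by
        have := Ideal.sub_mem _ hm (Ideal.mul_mem_right _ _ ht : t * H₀ ∈ maximalIdeal L)
        rwa [add_sub_cancel_right] at this
      exact (maximalIdeal.isMaximal L).ne_top (Ideal.eq_top_of_isUnit_mem _ this hGu)
    have h1 : t * (G + t * H₀) ∈ maximalIdeal L ^ 2 := by
      have : t * (G + t * H₀) = g₁ - alg (chartGen c i 2) ^ 2 := by rw [hg₁, hFG]; ring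
      rw [this]
      exact Ideal.sub_mem _ hg₁m (Ideal.pow_mem_pow hz 2)
    have : (G + t * H₀) * t ^ 1 ∈ maximalIdeal L ^ (1 + 1) := by rw [pow_one, mul_comm]; exact h1
    exact unit_mul_pow_not_mem_pow_succ ht2 hunitv 1 this
  · -- `μ = 3`: `F = ρ³ G + t H₀`; clean with the window presentation
    have hFeq : F = ρ ^ 3 * G + t * H₀ := by
      have := hH₀; rw [mul_comm] at this; linear_combination -this
    have hz₁ : z₁ ∈ maximalIdeal L :=
      hxyz₁ ▸ Ideal.subset_span (Set.mem_insert_of_mem _ (Set.mem_insert_of_mem _ (Set.mem_singleton _)))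
    have hf₁ : ∑ k ∈ Finset.range (3 + 1), a₁ k * x₁ ^ (3 - k) * y₁ ^ k ∈ maximalIdeal L ^ 3 := by
      have hle : Ideal.span {x₁, y₁} ≤ maximalIdeal L := by
        rw [← hxyz₁]
        refine Ideal.span_mono ?_
        intro b hb
        rcases hb with rfl | rfl
        · exact Set.mem_insert _ _
        · exact Set.mem_insert_of_mem _ (Set.mem_insert _ _)
      exact Ideal.pow_right_mono hle 3 (coeffForm_mem_span_pow x₁ y₁ 3 a₁)
    have hρm : ρ ∈ maximalIdeal L := hgen ▸ Ideal.subset_span (Set.mem_insert_of_mem _ (Set.mem_insert _ _))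
    have hr₃ : t * ρ ^ 3 * G ∈ maximalIdeal L ^ 3 := by
      have h1 := Ideal.mul_mem_mul ht (Ideal.pow_mem_pow hρm 2)
      rw [← pow_succ'] at h1
      have : t * ρ ^ 3 * G = (t * ρ ^ 2) * (ρ * G) := by ring
      rw [this]
      exact Ideal.mul_mem_right _ _ h1
    have hg₁' : g₁ = alg (chartGen c i 2) ^ 2 + (t ^ 2 * H₀ + t * ρ ^ 3 * G) := by rw [hg₁, hFeq]; ring
    have heq₀ : Ideal.span {alg (chartGen c i 2) ^ 2 + (t ^ 2 * H₀ + t * ρ ^ 3 * G)} =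
        Ideal.span {z₁ ^ 2 + ∑ k ∈ Finset.range (3 + 1), a₁ k * x₁ ^ (3 - k) * y₁ ^ k} := by
      rw [← hg₁', ← hI'eq, hI₁]
    obtain ⟨σ, hσ⟩ := exists_sq_congr_of_window h3L hgen hr₃ hz₁ hf₁ heq₀
    obtain ⟨η, η_S, η_Q, η_W, hgen', hid, hηm, hηlin, -, hr4⟩ := cubeChild_shape hgen hFeq hσ
    have hI'shape : I' = Ideal.span {(alg (chartGen c i 2) + σ * t) ^ 2 + (t ^ 2 * η + t * ρ ^ 3 * G)} := by
      rw [hI'eq, hg₁, hid]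
    refine ⟨t, ρ, alg (chartGen c i 2) + σ * t, η, t * ρ ^ 3 * G, η_S, η_Q, η_W, hgen', hηlin, hI'shape, ?_⟩
    by_cases hQ : IsUnit η_Q
    · exact Or.inl ⟨hQ, hr4⟩
    · right
      have hQm : η_Q ∈ maximalIdeal L := (mem_maximalIdeal _).mpr (mem_nonunits_iff.mpr hQ)
      by_cases hS : IsUnit η_S
      · exact ⟨G, hGu, rfl, hS, hQm⟩
      · -- degenerate: contradicts the window presentation at the point
        exfalso
        have hSm : η_S ∈ maximalIdeal L := (mem_maximalIdeal _).mpr (mem_nonunits_iff.mpr hS)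
        have heq₁ : Ideal.span {(alg (chartGen c i 2) + σ * t) ^ 2 + (t ^ 2 * η + t * ρ ^ 3 * G)} =
            Ideal.span {z₁ ^ 2 + ∑ k ∈ Finset.range (3 + 1), a₁ k * x₁ ^ (3 - k) * y₁ ^ k} := by
          rw [← hI'shape, hI₁]
        exact not_window_of_degenerate h3L hgen' hηlin hSm hQm hr4 hxyz₁ hunit₁ heq₁

/-- Reflection of the `y`-chart residue polynomial: `Σ_{k ≤ 3} C(b k) X^{3−k} = Σ_{k ≤ 3} C(b (3−k)) X^k`. [folklore] -/
theorem cubicSum_reflect {κ : Type*} [Field κ] (b : ℕ → κ) :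
    (∑ k ∈ Finset.range (3 + 1), C (b k) * X ^ (3 - k)) = ∑ k ∈ Finset.range (3 + 1), C (b (3 - k)) * X ^ k := by
  have h := Finset.sum_range_reflect (fun k => C (b k) * X ^ (3 - k)) (3 + 1)
  rw [← h]
  refine Finset.sum_congr rfl fun k hk => ?_
  have hkd : k ≤ 3 := Nat.lt_succ_iff.mp (Finset.mem_range.mp hk)
  simp only [show 3 + 1 - 1 - k = 3 - k from by omega, Nat.sub_sub_self hkd]

end MohWindowSurface

/-! ## 2. Scheme level: every singular point over an admitted centre is frozen or pure -/

section Campaign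

variable {K : Type u} [Field K] [CharP K 2]
variable {A A' : AmbientDatum 2 K} {E : IdealExponent A.Z}

/-- **[OURS · L1 W4.6 rung (iii-2), `p = 2`] EVERY SINGULAR POINT OVER AN ADMITTED CENTRE IS FROZEN OR PURE.** Let `π : Z′ → Z` be
a §2.1-permissible blow-up of a state `(A, E)` of `Regime.mohWindowSurface` (`p = 2`) whose transform is again in the regime. Then
at every singular point `x′` of `E′` over the centre, `J′_{x′} = (w² + (s²η + r))` in a regular system of parameters `(s, q, w)` with
`η ≡ η_S s + η_Q q + η_W w (mod 𝔪²)` and EITHER `η_Q` a unit, `r ∈ 𝔪⁴` (FROZEN: never again a centre, `…FrozenShape.lean` +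
`…Freeze.lean`) OR `r = s q³ G`, `G`, `η_S` units, `η_Q ∈ 𝔪` (PURE: its own children are all frozen, `…PureChildStep.lean`).
NOT a statement of the manuscript. [folklore] -/
theorem frozen_or_pure_of_over_centre {D : Closeds A.Z} (π : A'.Z ⟶ A.Z) (hπ : IsBlowup π (vanishingIdeal D))
    (hD : E.IsPermissibleCentre A.hom D) (hRg : Regime.mohWindowSurface A E)
    (hRg' : Regime.mohWindowSurface A' (E.transform π D)) {x' : A'.Z} (hx' : x' ∈ (E.transform π D).sing)
    (hover : π.base x' ∈ (D : Set A.Z)) :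
    ∃ s q w η r η_S η_Q η_W : A'.Z.presheaf.stalk x', Ideal.span {s, q, w} = maximalIdeal _ ∧
      η - (η_S * s + η_Q * q + η_W * w) ∈ maximalIdeal _ ^ 2 ∧
      stalkIdeal (E.transform π D).J x' = Ideal.span {w ^ 2 + (s ^ 2 * η + r)} ∧
      ((IsUnit η_Q ∧ r ∈ maximalIdeal _ ^ 4) ∨
        (∃ G : A'.Z.presheaf.stalk x', IsUnit G ∧ r = s * q ^ 3 * G ∧ IsUnit η_S ∧ η_Q ∈ maximalIdeal _)) := by
  classical
  have hRg0 := hRg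
  obtain ⟨ξ, hξS, hξcl, hDξ⟩ := IsPermissibleCentre.exists_eq_singleton_of_isolatedSing hD ⟨hRg.2.1, hRg.2.2.1⟩
  have hπx : π.base x' = ξ := by simpa [hDξ] using hover
  obtain ⟨hb, -, -, hwin⟩ := hRg
  have hRg'' := hRg'
  obtain ⟨hb', -, -, hwin'⟩ := hRg'
  haveI : IsLocallyNoetherian A'.Z := by
    haveI := A'.smooth
    exact LocallyOfFiniteType.isLocallyNoetherian A'.hom
  -- the presentations downstairs and upstairs (`d = d₁ = 3`)
  obtain ⟨hRreg, h3, x, y, z, hxyz, d, a, hbd, hd2, hunit, hJ⟩ := hwin _ (hπx ▸ hξS)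
  rw [hb] at hbd hd2 hJ
  obtain rfl : d = 3 := by omega
  haveI := hRreg
  obtain ⟨hLreg, h3L, x₁, y₁, z₁, hxyz₁, d₁, a₁, hbd₁, hd2₁, hunit₁, hJ₁⟩ := hwin' _ hx'
  rw [show (E.transform π D).b = E.b from rfl, hb] at hbd₁ hd2₁ hJ₁
  obtain rfl : d₁ = 3 := by omega
  haveI := hLreg
  haveI : CharP (A'.Z.presheaf.stalk x') 2 := Lem16p11Proof.charP_stalk A π x'
  obtain ⟨hfac0, hfac1⟩ := cube_factor_of_transform_mem π hπ hD hRg0 hRg'' hover hxyz a hunit hJ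
  -- the Rees chart at `x'`
  set c : Fin 3 → A.Z.presheaf.stalk (π.base x') := ![x, y, z] with hc_def
  have hc : Ideal.span (Set.range c) = maximalIdeal _ := by rw [hc_def, MohWindowSurface.range_vec3]; exact hxyz
  have hY : stalkIdeal (vanishingIdeal D) (π.base x') = maximalIdeal (A.Z.presheaf.stalk (π.base x')) := by
    apply stalkIdeal_vanishingIdeal_eq_maximalIdeal_of_closure_eq
    rw [hDξ, hπx, hξcl.closure_eq]
  have hcY : Ideal.span (Set.range c) = stalkIdeal (vanishingIdeal D) (π.base x') := hc.trans hY.symm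
  obtain ⟨j, 𝔴, χ, hχ, hloc, h𝔴⟩ := hπ.exists_reesChart_stalk x' c hcY
  letI := χ.toAlgebra
  haveI : IsLocalization.AtPrime (A'.Z.presheaf.stalk x') 𝔴.asIdeal := hloc
  obtain ⟨ψ, hψ⟩ : ∃ ψ : A.Z.presheaf.stalk (π.base x') →+* A'.Z.presheaf.stalk x', ψ = (π.stalkMap x').hom := ⟨_, rfl⟩
  have hψa : ∀ r, ψ r = (algebraMap (chartRing c j) (A'.Z.presheaf.stalk x') :
      chartRing c j →+* A'.Z.presheaf.stalk x') (chartBase c j r) := fun r => by rw [hψ]; exact (hχ r).symm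
  have hrel : ∀ l, ψ (c l) = ψ (c j) * χ (chartGen c j l) := by
    rw [hψ]; exact stalkMap_apply_eq_mul_chartGen j χ hχ
  have hCmap : (stalkIdeal (vanishingIdeal D) (π.base x')).map ψ = Ideal.span {ψ (c j)} := by
    rw [← hcY, Ideal.map_span_range_eq_span_singleton _ c j _ hrel]
  have hstalk : stalkIdeal (E.transform π D).J x' =
      Submodule.colon (Ideal.span {ψ (z ^ 2 + ∑ k ∈ Finset.range (3 + 1), a k * x ^ (3 - k) * y ^ k)})
        ((Ideal.span {ψ (c j)} ^ 2 : Ideal _) : Set _) := by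
    show stalkIdeal (controlledTransform π (vanishingIdeal D) E.J E.b) x' = _
    rw [controlledTransform, stalkIdeal_colon, stalkIdeal_pow, stalkIdeal_comap_eq_map_stalkMap,
      stalkIdeal_comap_eq_map_stalkMap, ← hψ, hCmap, hJ, Ideal.map_span, Set.image_singleton, hb]
  have hx'sing : stalkIdeal (E.transform π D).J x' ≤ maximalIdeal _ ^ 2 := by
    have := (le_idealOrder_iff (E.transform π D).J x' (E.transform π D).b).mp hx'
    rwa [show (E.transform π D).b = E.b from rfl, hb] at this
  have hcj : ψ (c j) ∈ maximalIdeal _ := by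
    rw [hψa]
    exact (IsLocalization.AtPrime.to_map_mem_maximal_iff _ 𝔴.asIdeal _).mpr
      (by rw [← Ideal.mem_comap, h𝔴, ← hc]; exact Ideal.subset_span ⟨j, rfl⟩)
  haveI : IsDomain (A'.Z.presheaf.stalk x') := isDomain_of_isRegularLocalRing _
  -- which chart?
  obtain rfl | rfl | rfl : j = 0 ∨ j = 1 ∨ j = 2 := by
    rcases j with ⟨j, hj⟩
    have : j = 0 ∨ j = 1 ∨ j = 2 := by omega
    rcases this with rfl | rfl | rfl
    · exact Or.inl rfl
    · exact Or.inr (Or.inl rfl)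
    · exact Or.inr (Or.inr rfl)
  · -- chart `x`
    have hfac0' : ∀ π₀ : (ResidueField (A.Z.presheaf.stalk (π.base x')))[X], Prime π₀ → ∃ (μ : ℕ) (G₀ : _),
        (μ = 0 ∨ μ = 3) ∧ (∑ k ∈ Finset.range (3 + 1), C (residue _ (a k)) * X ^ (min k 3)) = π₀ ^ μ * G₀ ∧ ¬ π₀ ∣ G₀ := by
      intro π₀ hπ₀; rw [← residue_sum_chart_zero]; exact hfac0 π₀ hπ₀
    refine MohWindowSurface.centreChild_of_chart h3 c hc (i := 0) (i' := 1) (by decide) (by decide) (by decide) a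
      (fun k => min k 3) (fun k => min_le_right k 3) hfac0' 𝔴.asIdeal h𝔴 _ h3L ψ hψa (I' := stalkIdeal (E.transform π D).J x')
      ?_ hx'sing hxyz₁ hunit₁ hJ₁
    rw [hstalk, window_sum_chart_zero]
    rfl
  · -- chart `y`
    have hfac1' : ∀ π₀ : (ResidueField (A.Z.presheaf.stalk (π.base x')))[X], Prime π₀ → ∃ (μ : ℕ) (G₀ : _),
        (μ = 0 ∨ μ = 3) ∧ (∑ k ∈ Finset.range (3 + 1), C (residue _ (a k)) * X ^ (3 - k)) = π₀ ^ μ * G₀ ∧ ¬ π₀ ∣ G₀ := by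
      intro π₀ hπ₀; rw [MohWindowSurface.cubicSum_reflect]; exact hfac1 π₀ hπ₀
    refine MohWindowSurface.centreChild_of_chart h3 c hc (i := 1) (i' := 0) (by decide) (by decide) (by decide) a
      (fun k => 3 - k) (fun k => Nat.sub_le 3 k) hfac1' 𝔴.asIdeal h𝔴 _ h3L ψ hψa (I' := stalkIdeal (E.transform π D).J x')
      ?_ hx'sing hxyz₁ hunit₁ hJ₁
    rw [hstalk, window_sum_chart_one]
    rfl
  · -- chart `z`: the transform is the unit ideal — `x'` would not be singular
    exfalso
    have hfac := MohWindowSurface.map_window_eq_chart_two ψ (hrel 0) (hrel 1) (show 2 ≤ 3 by norm_num) a (d := 3)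
    have hunit2 := MohWindowSurface.isUnit_chart_two_cofactor hcj (show 2 < 3 by norm_num)
      (S := ∑ k ∈ Finset.range (3 + 1), ψ (a k) * χ (chartGen c 2 0) ^ (3 - k) * χ (chartGen c 2 1) ^ k)
    have hne : ψ (c 2) ≠ 0 := by
      have hz0 : Ideal.span (Set.range (Fin.append c (fun k : Fin 0 => Fin.elim0 k : Fin 0 → _))) = maximalIdeal _ := by
        rw [MohWindowSurface.span_range_append_elim0]; exact hc
      have hd0 : (maximalIdeal (A.Z.presheaf.stalk (π.base x'))).spanFinrank = 3 + 0 := by rw [h3]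
      have hrsop := isRsopPart_chartFamily_reesChart c 2 (fun k : Fin 0 => Fin.elim0 k) hz0 hd0 𝔴.asIdeal h𝔴
        (A'.Z.presheaf.stalk x') (a := 0) (fun k : Fin 0 => Fin.elim0 k) (Function.injective_of_subsingleton _)
        (fun k => Fin.elim0 k)
      have h0 := hrsop.ne_zero 0
      rw [hψa]; simpa only [chartFamily, Fin.cons_zero] using h0
    have htop : stalkIdeal (E.transform π D).J x' = ⊤ := by
      rw [hstalk]
      have : ψ (z ^ 2 + ∑ k ∈ Finset.range (3 + 1), a k * x ^ (3 - k) * y ^ k) =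
          ψ (c 2) ^ 2 * (1 + ψ (c 2) ^ (3 - 2) *
            ∑ k ∈ Finset.range (3 + 1), ψ (a k) * χ (chartGen c 2 0) ^ (3 - k) * χ (chartGen c 2 1) ^ k) := hfac
      rw [this, MohWindowSurface.colon_span_pow_mul (mem_nonZeroDivisors_of_ne_zero hne), Ideal.span_singleton_eq_top]
      exact hunit2
    have h1 : (1 : A'.Z.presheaf.stalk x') ∈ maximalIdeal _ := by
      have := hx'sing (htop ▸ Submodule.mem_top : (1 : A'.Z.presheaf.stalk x') ∈ stalkIdeal (E.transform π D).J x')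
      exact Ideal.pow_le_self two_ne_zero this
    exact (maximalIdeal.isMaximal _).ne_top ((Ideal.eq_top_iff_one _).mpr h1)

/-- **[OURS · L1 W4.6 rung (iii-2), `p = 2`] A FROZEN POINT IS NEVER AN ADMITTED CENTRE.** If a state `(A, E)` of
`Regime.mohWindowSurface` (`p = 2`) is blown up permissibly at a centre containing a point `x` whose window ideal has the frozen
shape `J_x = (w² + (s²η + r))`, `η ≡ η_S s + η_Q q + η_W w (mod 𝔪²)` with `η_Q` a unit, `r ∈ 𝔪⁴`, then the transform is NOT in
the regime (`…FrozenShape.lean`: the regime's presentation at `x` has a simple factor in one chart; `…Freeze.lean`). NOT a statement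
of the manuscript. [folklore] -/
theorem not_mohWindowSurface_transform_of_frozen_centre {D : Closeds A.Z} (π : A'.Z ⟶ A.Z)
    (hπ : IsBlowup π (vanishingIdeal D)) (hD : E.IsPermissibleCentre A.hom D) (hRg : Regime.mohWindowSurface A E)
    {x : A.Z} (hxD : x ∈ (D : Set A.Z)) (hxS : x ∈ E.sing) {s q w η r η_S η_Q η_W : A.Z.presheaf.stalk x}
    (hsqw : Ideal.span {s, q, w} = maximalIdeal _) (hη : η - (η_S * s + η_Q * q + η_W * w) ∈ maximalIdeal _ ^ 2)
    (hηQ : IsUnit η_Q) (hr : r ∈ maximalIdeal _ ^ 4) (hJ : stalkIdeal E.J x = Ideal.span {w ^ 2 + (s ^ 2 * η + r)}) :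
    ¬ Regime.mohWindowSurface A' (E.transform π D) := by
  classical
  have hRg0 := hRg
  obtain ⟨hb, -, -, hwin⟩ := hRg
  obtain ⟨hLreg, h3L, x₁, y₁, z₁, hxyz₁, d₁, a₁, hbd₁, hd2₁, -, hJ₁⟩ := hwin _ hxS
  rw [hb] at hbd₁ hd2₁ hJ₁
  obtain rfl : d₁ = 3 := by omega
  haveI := hLreg
  haveI : CharP (A.Z.presheaf.stalk x) 2 := Lem16p11Proof.charP_stalk A (𝟙 A.Z) x
  have heq : Ideal.span {w ^ 2 + (s ^ 2 * η + r)} =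
      Ideal.span {z₁ ^ 2 + ∑ k ∈ Finset.range (3 + 1), a₁ k * x₁ ^ (3 - k) * y₁ ^ k} := by rw [← hJ, ← hJ₁]
  rcases MohWindowSurface.exists_simple_factor_of_frozenShape h3L hsqw hη hηQ hr hxyz₁ a₁ heq with
    ⟨π₀, G₀, hπ₀, hF, hG₀⟩ | ⟨π₀, G₀, hπ₀, hF, hG₀⟩
  · exact not_mohWindowSurface_transform_of_simple_root π hπ hD hRg0 hxD hxyz₁ (by norm_num) a₁ hJ₁ hπ₀ hF hG₀
  · have hyxz₁ : Ideal.span {y₁, x₁, z₁} = maximalIdeal _ := by rw [← hxyz₁, Set.insert_comm]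
    have hJ₁' : stalkIdeal E.J x = Ideal.span {z₁ ^ 2 + ∑ k ∈ Finset.range (3 + 1), a₁ (3 - k) * y₁ ^ (3 - k) * x₁ ^ k} := by
      rw [hJ₁, MohWindowSurface.coeffForm_swap]
    exact not_mohWindowSurface_transform_of_simple_root π hπ hD hRg0 hxD hyxz₁ (by norm_num) (fun k => a₁ (3 - k)) hJ₁' hπ₀
      hF hG₀

end Campaign

end CampaignW46

end Summit.ResolutionOfSingularities.ResolutionOfSingularities.Theorems

end
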